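import Literature.NumberTheory.Automorphic.RamakrishnanTensorProductGL2Proofs
import Literature.NumberTheory.Automorphic.RamakrishnanTheoremMProofs
import Literature.NumberTheory.Automorphic.AutomorphicTwistHecke
import Literature.NumberTheory.Automorphic.CuspidalDescentDetCubicRepData
import Literature.NumberTheory.Automorphic.GLOneOfHeckeCharacterBJ
import Literature.NumberTheory.Automorphic.RamakrishnanMultiplicityOneLemma414
import HarnessLib

/-!
# Ramakrishnan (2000), Theorem 4.1.2: the discharge needs only the cuspidal case of Theorem M
# (assembly from `Ramakrishnan2000_boxTimes_cuspidal`), and the twist normalisation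

Topic `NumberTheory/Automorphic`; namespace `Literature.NumberTheory.Automorphic`. Proof file
(theorems only: no definition, no named fact, no instance, no `sorry`) towards the discharge
`Ramakrishnan2000_multiplicityOneSL2_holds` of the named fact `Ramakrishnan2000_multiplicityOneSL2`
(`RamakrishnanTensorProductGL2`): D. Ramakrishnan, *Modularity of the Rankin–Selberg `L`-series, and
multiplicity one for `SL(2)`*, Ann. of Math. (2) 152 (2000), 45–111, **Theorem 4.1.2** (§4.1,
preprint `paper:galaxy-pdf-4279542020`, chunks 49–52): for cuspidal `π, π'` on `GL(2)/F` with
`Ad(π_v) ≃ Ad(π'_v)` for almost all `v` — in the tree's rendering `(LL)`: `t_{π',v} = c_v t_{π,v}`,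
`c_v ≠ 0`, a.e. — there is an idele class character `χ` with `π' ≃ π ⊗ χ` (`IsSatakeTwistBy`).

The siblings `RamakrishnanTensorProductGL2Proofs` (assembly `…of_theoremM`) and
`RamakrishnanMultiplicityOneLemma414` (Lemma 4.1.4 from Jacquet–Shalika (2.1)–(2.3) and
Gelbart–Jacquet, assembly `…of_theoremM_of_JS_of_leaves`) reduce the fact to the named fact
`Ramakrishnan2000_theoremM` — the *whole* of Theorem M: Existence of `π ⊠ π'` for every cuspidal
pair and both halves of the cuspidality criterion — plus standard leaves and the both-dihedral case.
This file records that **the printed proof of Thm. 4.1.2 uses only the "if" half of the criterion**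
(op. cit. p. 39: "`π, π'` are non-dihedral cusp forms on `GL(2)/F` with `π ⊠ π'` not cuspidal. Then
by the cuspidality criterion of Theorem M …, `π'` must be isomorphic to `π ⊗ χ`" — i.e. (C) ⇒
`π ⊠ π'` cuspidal, contrapositively), which is the content of the *weaker* named fact
`Ramakrishnan2000_boxTimes_cuspidal` (`RamakrishnanBoxTimes`: Existence + "if" half, for non-dihedral
pairs only). Consequently neither the Existence clause of Theorem M for dihedral or twist-equivalent
pairs (op. cit. Lemma 3.1.1 (II), (III): isobaric automorphic induction, hypothesis (R1) of
`Ramakrishnan2000_theoremM.of_boxTimes_cuspidal`) nor its "only if" half is on the path to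
`Ramakrishnan2000_multiplicityOneSL2_holds`.

## What is proved here

1. `Ramakrishnan2000_multiplicityOneSL2.nonDihedral_of_boxTimes_cuspidal`,
   `Ramakrishnan2000_multiplicityOneSL2.of_boxTimes_cuspidal` — the non-dihedral case and the assembly
   of Thm. 4.1.2 from `Ramakrishnan2000_boxTimes_cuspidal` (bridge
   `Ramakrishnan2000_theoremM.exists_cuspidal_of_boxTimes_cuspidal` of `RamakrishnanTheoremMProofs`),
   Lemma 4.1.4 in the tree's rendering and the both-dihedral case; the mixed cases do not occur
   (`isSatakeSelfTwist_iff_of_LL`).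
2. Consequently — feeding hypothesis (b) of `…of_boxTimes_cuspidal` with
   `Ramakrishnan2000_lemma414_of_JS_of_sSup_irreducible` of `RamakrishnanMultiplicityOneLemma414`,
   exactly as `Ramakrishnan2000_multiplicityOneSL2.of_theoremM_of_JS_of_leaves` feeds `…of_theoremM` —
   **what separates `Ramakrishnan2000_multiplicityOneSL2_holds` from the tree** is
   `Ramakrishnan2000_boxTimes_cuspidal`, Jacquet–Shalika (2.1)–(2.3) for Borel–Jacquet data
   (`JacquetShalika1981_{multipliable_partialPairL,partialPairL_boundary,partialPairL_pole}_repData`),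
   `GelbartJacquet_adjoint_lift`, the Borel–Jacquet dictionary leaves at rank `2`
   (`AutomorphicRepsGL.exists_isAssociatedL2`, `hasSatakeParamAt_iff_L2`,
   `AutomorphicRepsGL.stable_cuspidal_eq_sSup_irreducible`), and the both-dihedral case (op. cit.
   p. 38, via the image of automorphic induction from quadratic `K`, Prop. 2.3.1 (2) — absent from
   the tree; the hypothesis `hdih`, as in the sibling assemblies):
   `Ramakrishnan2000_multiplicityOneSL2.of_boxTimes_cuspidal_of_JS`, `…of_boxTimes_leaves` (§3).
3. **Twist normalisation** ("we may assume `π` unitary", Borel–Jacquet 1979, 5.7; the *Unitarity*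
   remark of the module docstring of `RamakrishnanTensorProductGL2`): `(LL)` is transported along
   Satake twists (`eventually_LL_of_isSatakeTwistBy`), the twisting character is transported back
   (`exists_isSatakeTwistBy_of_twists`), so Thm. 4.1.2 need only be proved on any class of data
   containing a twist of every datum (`Ramakrishnan2000_multiplicityOneSL2.of_forall_exists_twist`) —
   e.g. the data with unitary Satake parameters, `|det t_{π,v}| = 1` a.e., produced from the central
   character by `exists_unitary_satakeTwist_of_centralCharacter` (`|Ω(ϖ_v)| = q_v^{-σ}`,
   `norm_valueAtUniformizer_eq_rpow_neg`, from `|Ω| = ‖·‖^σ` and the norm powers `‖·‖^s` of the tree).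

## References

* D. Ramakrishnan, *Modularity of the Rankin–Selberg `L`-series, and multiplicity one for `SL(2)`*,
  Ann. of Math. (2) 152 (2000), 45–111, doi:10.2307/2661379: Theorem M (§3), Lemma 3.1.1,
  Prop. 3.2.1, Thm. 4.1.2 and its proof, Lemma 4.1.4 (§4.1, preprint pp. 37–39). [Ramakrishnan2000]
* A. Borel, H. Jacquet, *Automorphic forms and automorphic representations*, Proc. Sympos. Pure
  Math. 33 (1979), part 1, §5.7. [BorelJacquetCorvallis1979]
* J. Tate, *Fourier analysis in number fields and Hecke's zeta-functions*, in Cassels–Fröhlich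
  (1967), Ch. XV, §4.3. [TateThesis1967]
* D. Flath, *Decomposition of representations into tensor products*, Corvallis (1979), Thm. 3.
  [FlathCorvallis1979]
-/

noncomputable section

open scoped MatrixGroups NumberField Classical Topology
open NumberField IsDedekindDomain MeasureTheory Filter

namespace Literature.NumberTheory.Automorphic

open AdelicGroupData
open Literature.NumberTheory.GaloisRepresentations (HeckeCharacter ideleGroup localUnits)

/-! ### 1. Assembly from the cuspidal case of Theorem M (`Ramakrishnan2000_boxTimes_cuspidal`) -/

section Assembly

variable {F : Type} [Field F] [NumberField F]

/-- **The non-dihedral case of Thm. 4.1.2 from the cuspidal case of Theorem M** (op. cit. p. 39: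
"Thus `π, π'` are non-dihedral cusp forms on `GL(2)/F` with `π ⊠ π'` not cuspidal. Then by the
cuspidality criterion of Theorem M …, we see that `π'` must be isomorphic to `π ⊗ χ`"). Granting the
named fact `Ramakrishnan2000_boxTimes_cuspidal` (Existence + the "if" half of the criterion): if
neither `π` nor `π'` admits a non-trivial self-twist and no cuspidal `Π` on `GL(4)/F` has the Satake
parameters `t_π ⊗ t_{π'}` almost everywhere (Lemma 4.1.4 in the tree's rendering), then `π'` is a
twist of `π` by a Hecke character at the level of Satake parameters a.e. — for otherwise condition
(C) holds and the fact produces such a cuspidal `Π`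
(`Ramakrishnan2000_theoremM.exists_cuspidal_of_boxTimes_cuspidal`).
[cite: Ramakrishnan2000, Theorem M (§3), Prop. 3.2.1 and §4.1, Lemma 4.1.4] -/
theorem Ramakrishnan2000_multiplicityOneSL2.nonDihedral_of_boxTimes_cuspidal
    (hB : Ramakrishnan2000_boxTimes_cuspidal)
    (h2 : isCompact_glFiniteIntegralLevel 2 F) (h4 : isCompact_glFiniteIntegralLevel 4 F)
    (π π' : CuspidalAutomorphicRepData 2 F h2) (hπ : ¬ IsSatakeSelfTwist π.1)
    (hπ' : ¬ IsSatakeSelfTwist π'.1)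
    (h414 : ¬ ∃ P : CuspidalAutomorphicRepData 4 F h4,
      ∀ᶠ v : HeightOneSpectrum (𝓞 F) in cofinite, ∀ α β : Multiset ℂ,
        π.1.HasSatakeParamAt v α → π'.1.HasSatakeParamAt v β →
          P.1.HasSatakeParamAt v (satakeTensor α β)) :
    ∃ χ : HeckeCharacter F, IsSatakeTwistBy π.1 π'.1 χ := by
  by_contra hC
  exact h414
    (Ramakrishnan2000_theoremM.exists_cuspidal_of_boxTimes_cuspidal hB h2 h4 π π' hπ hπ' hC)

/-- **Thm. 4.1.2 from the cuspidal case of Theorem M, Lemma 4.1.4 and the dihedral case** — the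
assembly `Ramakrishnan2000_multiplicityOneSL2.of_theoremM` with the named fact
`Ramakrishnan2000_theoremM` replaced by the weaker `Ramakrishnan2000_boxTimes_cuspidal` (only the
"if" half of the cuspidality criterion is used in the printed proof, op. cit. p. 39). Hypotheses:
(a) `Ramakrishnan2000_boxTimes_cuspidal`; (b) Lemma 4.1.4 in the tree's rendering — under `(LL)` and
in the absence of self-twists, no cuspidal `Π` on `GL(4)/F` has Satake parameters `t_π ⊗ t_{π'}`
a.e.; (c) the conclusion when both `π` and `π'` admit a non-trivial self-twist. The mixed cases do
not occur (`isSatakeSelfTwist_iff_of_LL`); the level input at rank `4` is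
`isCompact_glFiniteIntegralLevel_holds`. [cite: Ramakrishnan2000, §4.1, proof of Thm. 4.1.2] -/
theorem Ramakrishnan2000_multiplicityOneSL2.of_boxTimes_cuspidal
    (hB : Ramakrishnan2000_boxTimes_cuspidal)
    (h414 : ∀ (F : Type) [Field F] [NumberField F] (h2 : isCompact_glFiniteIntegralLevel 2 F)
      (h4 : isCompact_glFiniteIntegralLevel 4 F) (π π' : CuspidalAutomorphicRepData 2 F h2),
      (∀ᶠ v : HeightOneSpectrum (𝓞 F) in cofinite, ∃ (α : Multiset ℂ) (c : ℂ), c ≠ 0 ∧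
        π.1.HasSatakeParamAt v α ∧ π'.1.HasSatakeParamAt v (α.map (c * ·))) →
      ¬ IsSatakeSelfTwist π.1 → ¬ IsSatakeSelfTwist π'.1 →
      ¬ ∃ P : CuspidalAutomorphicRepData 4 F h4,
        ∀ᶠ v : HeightOneSpectrum (𝓞 F) in cofinite, ∀ α β : Multiset ℂ,
          π.1.HasSatakeParamAt v α → π'.1.HasSatakeParamAt v β →
            P.1.HasSatakeParamAt v (satakeTensor α β))
    (hdih : ∀ (F : Type) [Field F] [NumberField F] (h2 : isCompact_glFiniteIntegralLevel 2 F)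
      (π π' : CuspidalAutomorphicRepData 2 F h2),
      (∀ᶠ v : HeightOneSpectrum (𝓞 F) in cofinite, ∃ (α : Multiset ℂ) (c : ℂ), c ≠ 0 ∧
        π.1.HasSatakeParamAt v α ∧ π'.1.HasSatakeParamAt v (α.map (c * ·))) →
      IsSatakeSelfTwist π.1 → IsSatakeSelfTwist π'.1 →
      ∃ χ : HeckeCharacter F, IsSatakeTwistBy π.1 π'.1 χ) :
    Ramakrishnan2000_multiplicityOneSL2 := by
  intro F _ _ h2 π π' hLL
  by_cases hπ : IsSatakeSelfTwist π.1
  · exact hdih F h2 π π' hLL hπ ((isSatakeSelfTwist_iff_of_LL π.1 π'.1 hLL).mp hπ)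
  · have hπ' : ¬ IsSatakeSelfTwist π'.1 := fun h =>
      hπ ((isSatakeSelfTwist_iff_of_LL π.1 π'.1 hLL).mpr h)
    have h4 := isCompact_glFiniteIntegralLevel_holds 4 F
    exact Ramakrishnan2000_multiplicityOneSL2.nonDihedral_of_boxTimes_cuspidal hB h2 h4 π π' hπ
      hπ' (h414 F h2 h4 π π' hLL hπ hπ')

end Assembly

/-! ### 2. Twist normalisation: Thm. 4.1.2 is invariant under twisting `π`, `π'` -/

section Twist

variable {n : ℕ} {F : Type} [Field F] [NumberField F] {hF : isCompact_glFiniteIntegralLevel n F}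

/-- Satake twists compose: `π' = π ⊗ χ₁`, `π'' = π' ⊗ χ₂` a.e. give `π'' = π ⊗ χ₁χ₂` a.e. (a local copy
of `IsSatakeTwistBy.trans` of `RamakrishnanTensorProductGL2Proofs`). [folklore] -/
private theorem isSatakeTwistBy_trans' {π π' π'' : AutomorphicRepData (AutomorphyDatum.gl n F hF)}
    {χ₁ χ₂ : HeckeCharacter F} (h₁ : IsSatakeTwistBy π π' χ₁) (h₂ : IsSatakeTwistBy π' π'' χ₂) :
    IsSatakeTwistBy π π'' (χ₁ * χ₂) := by
  filter_upwards [h₁, h₂] with v hv₁ hv₂ α hα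
  have e : α.map ((χ₁ * χ₂).valueAtUniformizer v * ·) =
      (α.map (χ₁.valueAtUniformizer v * ·)).map (χ₂.valueAtUniformizer v * ·) := by
    rw [Multiset.map_map]
    refine Multiset.map_congr rfl fun x _ => ?_
    simp only [Function.comp_apply, GaloisRepresentations.HeckeCharacter.valueAtUniformizer_mul]
    ring
  rw [e]
  exact hv₂ _ (hv₁ α hα)

/-- Satake twists invert: `π' = π ⊗ χ` a.e. gives `π = π' ⊗ χ⁻¹` a.e., by the proved facts that `π`
is unramified almost everywhere and that Satake parameters are unique (a local copy of
`IsSatakeTwistBy.symm_inv` of `RamakrishnanTensorProductGL2Proofs`). [cite: FlathCorvallis1979, Thm. 3] -/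
private theorem isSatakeTwistBy_symm_inv' {π π' : AutomorphicRepData (AutomorphyDatum.gl n F hF)}
    {χ : HeckeCharacter F} (h : IsSatakeTwistBy π π' χ) : IsSatakeTwistBy π' π χ⁻¹ := by
  filter_upwards [h, π.hasSatakeParamAt_cofinite_holds] with v hv hur β hβ
  obtain ⟨α, hα⟩ := hur
  obtain rfl : β = α.map (χ.valueAtUniformizer v * ·) :=
    π'.hasSatakeParamAt_unique_holds hβ (hv α hα)
  have e : (α.map (χ.valueAtUniformizer v * ·)).map (χ⁻¹.valueAtUniformizer v * ·) = α := by
    rw [Multiset.map_map]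
    conv_rhs => rw [← Multiset.map_id α]
    refine Multiset.map_congr rfl fun x _ => ?_
    simp only [Function.comp_apply, GaloisRepresentations.HeckeCharacter.valueAtUniformizer_inv, id]
    rw [← mul_assoc, inv_mul_cancel₀ (heckeCharacter_valueAtUniformizer_ne_zero χ v), one_mul]
  rw [e]
  exact hα

/-- **`(LL)` is transported along twists.** If `t_{π',v} = c_v t_{π,v}` (`c_v ≠ 0`) a.e., and
`π₁ = π ⊗ ν`, `π₁' = π' ⊗ ν'` at the level of Satake parameters (`IsSatakeTwistBy`), then
`t_{π₁',v} = c'_v t_{π₁,v}` a.e. with `c'_v = ν'(ϖ_v) c_v ν(ϖ_v)⁻¹ ≠ 0`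
(`Ad(π ⊗ ν) = Ad(π)`). [folklore] -/
theorem eventually_LL_of_isSatakeTwistBy {π π' π₁ π₁' : AutomorphicRepData (AutomorphyDatum.gl n F hF)}
    {ν ν' : HeckeCharacter F}
    (hLL : ∀ᶠ v : HeightOneSpectrum (𝓞 F) in cofinite, ∃ (α : Multiset ℂ) (c : ℂ), c ≠ 0 ∧
      π.HasSatakeParamAt v α ∧ π'.HasSatakeParamAt v (α.map (c * ·)))
    (h₁ : IsSatakeTwistBy π π₁ ν) (h₁' : IsSatakeTwistBy π' π₁' ν') :
    ∀ᶠ v : HeightOneSpectrum (𝓞 F) in cofinite, ∃ (α : Multiset ℂ) (c : ℂ), c ≠ 0 ∧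
      π₁.HasSatakeParamAt v α ∧ π₁'.HasSatakeParamAt v (α.map (c * ·)) := by
  filter_upwards [hLL, h₁, h₁'] with v hv hv₁ hv₁'
  obtain ⟨α, c, hc, hα, hα'⟩ := hv
  refine ⟨α.map (ν.valueAtUniformizer v * ·),
    ν'.valueAtUniformizer v * c * (ν.valueAtUniformizer v)⁻¹,
    mul_ne_zero (mul_ne_zero (heckeCharacter_valueAtUniformizer_ne_zero ν' v) hc)
      (inv_ne_zero (heckeCharacter_valueAtUniformizer_ne_zero ν v)), hv₁ α hα, ?_⟩
  have h := hv₁' _ hα'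
  have e : (α.map (ν.valueAtUniformizer v * ·)).map
      (ν'.valueAtUniformizer v * c * (ν.valueAtUniformizer v)⁻¹ * ·) =
      (α.map (c * ·)).map (ν'.valueAtUniformizer v * ·) := by
    simp only [Multiset.map_map, Function.comp_def]
    refine Multiset.map_congr rfl fun x _ => ?_
    field_simp [heckeCharacter_valueAtUniformizer_ne_zero ν v]
  rw [e]
  exact h

/-- **The conclusion of Thm. 4.1.2 is transported back along twists**: if `π₁ = π ⊗ ν`,
`π₁' = π' ⊗ ν'` and `π₁' = π₁ ⊗ χ₁` at the level of Satake parameters a.e., then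
`π' = π ⊗ (ν χ₁ ν'⁻¹)` likewise (composition and inversion of Satake twists, as in
`IsSatakeTwistBy.trans`, `IsSatakeTwistBy.symm_inv` of `RamakrishnanTensorProductGL2Proofs`).
[folklore] -/
theorem exists_isSatakeTwistBy_of_twists {π π' π₁ π₁' : AutomorphicRepData (AutomorphyDatum.gl n F hF)}
    {ν ν' : HeckeCharacter F} (h₁ : IsSatakeTwistBy π π₁ ν) (h₁' : IsSatakeTwistBy π' π₁' ν')
    (h : ∃ χ₁ : HeckeCharacter F, IsSatakeTwistBy π₁ π₁' χ₁) :
    ∃ χ : HeckeCharacter F, IsSatakeTwistBy π π' χ := by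
  obtain ⟨χ₁, hχ₁⟩ := h
  exact ⟨ν * χ₁ * ν'⁻¹, isSatakeTwistBy_trans' (isSatakeTwistBy_trans' h₁ hχ₁)
    (isSatakeTwistBy_symm_inv' h₁')⟩

/-- **Normalisation principle for Thm. 4.1.2** ("we may assume `π` unitary": Borel–Jacquet 1979,
5.7, `π = π⁰ ⊗ |det|^s`; here for twists by arbitrary Hecke characters). Let `P` be any property of
cuspidal Borel–Jacquet data on `GL(2)` such that every datum has a Satake twist `π ⊗ ν` with
property `P`. If Thm. 4.1.2 (in the rendering of `Ramakrishnan2000_multiplicityOneSL2`) holds for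
all pairs of data with property `P`, it holds for all pairs: transport `(LL)` to the twists
(`eventually_LL_of_isSatakeTwistBy`) and the twisting character back
(`exists_isSatakeTwistBy_of_twists`). [cite: BorelJacquetCorvallis1979, §5.7] -/
theorem Ramakrishnan2000_multiplicityOneSL2.of_forall_exists_twist
    (P : ∀ ⦃F : Type⦄ [Field F] [NumberField F] ⦃h2 : isCompact_glFiniteIntegralLevel 2 F⦄,
      CuspidalAutomorphicRepData 2 F h2 → Prop)
    (hP : ∀ (F : Type) [Field F] [NumberField F] (h2 : isCompact_glFiniteIntegralLevel 2 F)
      (π : CuspidalAutomorphicRepData 2 F h2),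
      ∃ (π₁ : CuspidalAutomorphicRepData 2 F h2) (ν : HeckeCharacter F),
        P π₁ ∧ IsSatakeTwistBy π.1 π₁.1 ν)
    (h : ∀ (F : Type) [Field F] [NumberField F] (h2 : isCompact_glFiniteIntegralLevel 2 F)
      (π π' : CuspidalAutomorphicRepData 2 F h2), P π → P π' →
      (∀ᶠ v : HeightOneSpectrum (𝓞 F) in cofinite, ∃ (α : Multiset ℂ) (c : ℂ), c ≠ 0 ∧
        π.1.HasSatakeParamAt v α ∧ π'.1.HasSatakeParamAt v (α.map (c * ·))) →
      ∃ χ : HeckeCharacter F, IsSatakeTwistBy π.1 π'.1 χ) :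
    Ramakrishnan2000_multiplicityOneSL2 := by
  intro F _ _ h2 π π' hLL
  obtain ⟨π₁, ν, hP₁, hν⟩ := hP F h2 π
  obtain ⟨π₁', ν', hP₁', hν'⟩ := hP F h2 π'
  exact exists_isSatakeTwistBy_of_twists hν hν'
    (h F h2 π₁ π₁' hP₁ hP₁' (eventually_LL_of_isSatakeTwistBy hLL hν hν'))

/-- The idelic norm is positive. [folklore] -/
private theorem ideleNorm_pos'' (x : ideleGroup F) : 0 < GaloisRepresentations.ideleNorm x := by
  rw [← coe_ideleNorm]
  exact NNReal.coe_pos.2 (pos_iff_ne_zero.2 (ideleNorm_ne_zero x))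

/-- **`|Ω(ϖ_v)| = q_v^{-σ}` for the real exponent `σ` of `Ω`** (`|Ω| = ‖·‖^σ` on ideles, and
`‖ϖ_v‖ = q_v⁻¹`): computed through the norm-power character `‖·‖^σ`, whose value at `ϖ_v` is
`q_v^{-σ}` (`HeckeCharacter.valueAtUniformizer_of_cpow`). [cite: TateThesis1967, §4.3] -/
theorem norm_valueAtUniformizer_eq_rpow_neg {Ω : HeckeCharacter F} {σ : ℝ}
    (hσ : ∀ x : ideleGroup F, ‖((Ω x : ℂˣ) : ℂ)‖ = GaloisRepresentations.ideleNorm x ^ σ)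
    (v : HeightOneSpectrum (𝓞 F)) :
    ‖Ω.valueAtUniformizer v‖ = (v.residueCard : ℝ) ^ (-σ) := by
  obtain ⟨χ, hχ⟩ := exists_heckeCharacter_ideleNorm_cpow F (σ : ℂ)
  -- `‖Ω x‖ = ‖χ x‖` for all ideles `x`
  have hΩχ : ∀ x : ideleGroup F, ‖((Ω x : ℂˣ) : ℂ)‖ = ‖((χ x : ℂˣ) : ℂ)‖ := fun x => by
    rw [hσ x, hχ x, Complex.norm_cpow_eq_rpow_re_of_pos (ideleNorm_pos'' x), Complex.ofReal_re]
  have h1 : ‖Ω.valueAtUniformizer v‖ = ‖χ.valueAtUniformizer v‖ := by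
    simp only [GaloisRepresentations.HeckeCharacter.valueAtUniformizer,
      GaloisRepresentations.HeckeCharacter.localComponent_apply]
    exact hΩχ _
  rw [h1, HeckeCharacter.valueAtUniformizer_of_cpow hχ v, norm_inv,
    Complex.norm_natCast_cpow_of_pos (Nat.zero_lt_of_lt v.one_lt_residueCard), Complex.ofReal_re,
    Real.rpow_neg (Nat.cast_nonneg _)]

/-- **A unitary Satake twist from the central character.** Let `π` be a cuspidal Borel–Jacquet
datum on `GL_2(𝔸_F)` and `Ω` a Hecke character with `Ω(ϖ_v) = det t_{π,v} = ∏ t_{π,v}` for every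
Satake parameter of `π` at almost every `v` (the central character: conclusion of
`exists_heckeCharacter_prod_satake_of_sSup_irreducible`). Then some twist `π₁ = π ⊗ ν`
(`CuspidalAutomorphicRepData.exists_twist_hecke_hasSatakeParamAt`, with `ν = ‖·‖^{-σ/2}` for the real
exponent `σ` of `Ω`, `|Ω| = ‖·‖^σ`) has **unitary** Satake parameters, `|det t_{π₁,v}| = 1` a.e. —
the hypothesis `‖(α w).prod‖ = 1` of the Jacquet–Shalika facts of `PairLFunctionPolesRepData`
("we may assume `π` unitary", Borel–Jacquet 1979, 5.7). [cite: BorelJacquetCorvallis1979, §5.7] -/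
theorem exists_unitary_satakeTwist_of_centralCharacter {h2 : isCompact_glFiniteIntegralLevel 2 F}
    (π : CuspidalAutomorphicRepData 2 F h2) {Ω : HeckeCharacter F}
    (hΩ : ∀ᶠ v : HeightOneSpectrum (𝓞 F) in cofinite, ∀ α : Multiset ℂ,
      π.1.HasSatakeParamAt v α → Ω.valueAtUniformizer v = α.prod) :
    ∃ (π₁ : CuspidalAutomorphicRepData 2 F h2) (ν : HeckeCharacter F),
      (∀ᶠ v : HeightOneSpectrum (𝓞 F) in cofinite, ∀ α : Multiset ℂ,
        π₁.1.HasSatakeParamAt v α → ‖α.prod‖ = 1) ∧ IsSatakeTwistBy π.1 π₁.1 ν := by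
  obtain ⟨σ, hσ⟩ := Ω.exists_norm_apply_eq_ideleNorm_rpow
  obtain ⟨ν, hν⟩ := exists_heckeCharacter_ideleNorm_cpow F (-(σ / 2 : ℝ) : ℂ)
  obtain ⟨π₁, hπ₁⟩ := CuspidalAutomorphicRepData.exists_twist_hecke_hasSatakeParamAt ν π
  refine ⟨π₁, ν, ?_, hπ₁⟩
  have hq : ∀ v : HeightOneSpectrum (𝓞 F), (0 : ℝ) < v.residueCard := fun v =>
    Nat.cast_pos.2 (Nat.zero_lt_of_lt v.one_lt_residueCard)
  filter_upwards [hΩ, hπ₁, π.1.hasSatakeParamAt_cofinite_holds] with v hΩv hv hur β hβ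
  obtain ⟨α, hα⟩ := hur
  obtain rfl : β = α.map (ν.valueAtUniformizer v * ·) := π₁.1.hasSatakeParamAt_unique_holds hβ (hv α hα)
  rw [prod_map_const_mul_eq, hα.card_eq, ← hΩv α hα, norm_mul, norm_pow,
    norm_valueAtUniformizer_eq_rpow_neg hσ v, HeckeCharacter.valueAtUniformizer_of_cpow hν v,
    norm_inv, Complex.norm_natCast_cpow_of_pos (Nat.zero_lt_of_lt v.one_lt_residueCard)]
  simp only [Complex.neg_re, Complex.ofReal_re]
  rw [← Real.rpow_natCast, ← Real.rpow_neg (hq v).le, ← Real.rpow_mul (hq v).le,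
    ← Real.rpow_add (hq v)]
  norm_num

end Twist

/-! ### 3. The leaves of the tree below Thm. 4.1.2 -/

section Leaves

variable {F : Type} [Field F] [NumberField F]

/-- **Thm. 4.1.2 modulo the cuspidal case of Theorem M, Jacquet–Shalika (2.1)–(2.3),
Gelbart–Jacquet, the central characters of cuspidal `GL(2)` data and the both-dihedral case.**
As `Ramakrishnan2000_multiplicityOneSL2.of_theoremM_of_JS` (`RamakrishnanMultiplicityOneLemma414`,
Lemma 4.1.4 being `Ramakrishnan2000_lemma414_of_JS`), with `Ramakrishnan2000_theoremM` weakened to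
`Ramakrishnan2000_boxTimes_cuspidal`. [cite: Ramakrishnan2000, §4.1, Thm. 4.1.2 and Lemma 4.1.4] -/
theorem Ramakrishnan2000_multiplicityOneSL2.of_boxTimes_cuspidal_of_JS
    (hB : Ramakrishnan2000_boxTimes_cuspidal)
    (hJ1 : JacquetShalika1981_multipliable_partialPairL_repData)
    (hJ2 : JacquetShalika1981_partialPairL_boundary_repData)
    (hJ3 : JacquetShalika1981_partialPairL_pole_repData)
    (hGJ : GelbartJacquet_adjoint_lift)
    (hω : ∀ (F : Type) [Field F] [NumberField F] (h2 : isCompact_glFiniteIntegralLevel 2 F)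
      (π : CuspidalAutomorphicRepData 2 F h2), ∃ Ω : HeckeCharacter F,
        ∀ᶠ v : HeightOneSpectrum (𝓞 F) in cofinite, ∀ α : Multiset ℂ,
          π.1.HasSatakeParamAt v α → Ω.valueAtUniformizer v = α.prod)
    (hdih : ∀ (F : Type) [Field F] [NumberField F] (h2 : isCompact_glFiniteIntegralLevel 2 F)
      (π π' : CuspidalAutomorphicRepData 2 F h2),
      (∀ᶠ v : HeightOneSpectrum (𝓞 F) in cofinite, ∃ (α : Multiset ℂ) (c : ℂ), c ≠ 0 ∧
        π.1.HasSatakeParamAt v α ∧ π'.1.HasSatakeParamAt v (α.map (c * ·))) →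
      IsSatakeSelfTwist π.1 → IsSatakeSelfTwist π'.1 →
      ∃ χ : HeckeCharacter F, IsSatakeTwistBy π.1 π'.1 χ) :
    Ramakrishnan2000_multiplicityOneSL2 :=
  Ramakrishnan2000_multiplicityOneSL2.of_boxTimes_cuspidal hB
    (fun F _ _ h2 _ π π' hLL hπ _ =>
      Ramakrishnan2000_lemma414_of_JS hJ1 hJ2 hJ3 hGJ π π' (hω F h2 π) (hω F h2 π') hLL hπ)
    hdih

/-- **The leaves below `Ramakrishnan2000_multiplicityOneSL2_holds`.** The named fact follows from
(a) `Ramakrishnan2000_boxTimes_cuspidal` (Theorem M, cuspidal case: Existence + the "if" half of the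
criterion — the source of `χ`); (b) Jacquet–Shalika (2.1)–(2.3) for Borel–Jacquet data
(`PairLFunctionPolesRepData`) and `GelbartJacquet_adjoint_lift` (Lemma 4.1.4,
`Ramakrishnan2000_lemma414_of_JS_of_sSup_irreducible`); (c) the Borel–Jacquet dictionary and the
semisimplicity of `A_G`-invariant cusp forms at rank `2` (`AutomorphicRepsGL.exists_isAssociatedL2`,
`hasSatakeParamAt_iff_L2`, `AutomorphicRepsGL.stable_cuspidal_eq_sSup_irreducible`), through which
cuspidal data acquire central characters; (d) the both-dihedral case of the printed proof (op. cit.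
p. 38 — automorphic induction from quadratic `K` and Prop. 2.3.1 (2), not in the tree). Compared with
`Ramakrishnan2000_multiplicityOneSL2.of_theoremM_of_JS_of_leaves`, the Existence clause of Theorem M
for dihedral or twist-equivalent pairs (op. cit. Lemma 3.1.1 (II), (III)) and its "only if" half are
not required. [cite: Ramakrishnan2000, §4.1, proof of Thm. 4.1.2 and Lemma 4.1.4] -/
theorem Ramakrishnan2000_multiplicityOneSL2.of_boxTimes_leaves
    (hB : Ramakrishnan2000_boxTimes_cuspidal)
    (hJ1 : JacquetShalika1981_multipliable_partialPairL_repData)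
    (hJ2 : JacquetShalika1981_partialPairL_boundary_repData)
    (hJ3 : JacquetShalika1981_partialPairL_pole_repData)
    (hGJ : GelbartJacquet_adjoint_lift)
    (hAss : ∀ (F : Type) [Field F] [NumberField F] (h2 : isCompact_glFiniteIntegralLevel 2 F)
      (μ : Measure (gl 2 F).automorphicQuotient) [(gl 2 F).IsAutomorphicMeasure μ],
      AutomorphicRepsGL.exists_isAssociatedL2 h2 μ)
    (hL2 : ∀ (F : Type) [Field F] [NumberField F] (h2 : isCompact_glFiniteIntegralLevel 2 F)
      (μ : Measure (gl 2 F).automorphicQuotient) [(gl 2 F).IsAutomorphicMeasure μ],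
      hasSatakeParamAt_iff_L2 h2 μ)
    (hss : ∀ (F : Type) [Field F] [NumberField F] (h2 : isCompact_glFiniteIntegralLevel 2 F),
      AutomorphicRepsGL.stable_cuspidal_eq_sSup_irreducible h2)
    (hdih : ∀ (F : Type) [Field F] [NumberField F] (h2 : isCompact_glFiniteIntegralLevel 2 F)
      (π π' : CuspidalAutomorphicRepData 2 F h2),
      (∀ᶠ v : HeightOneSpectrum (𝓞 F) in cofinite, ∃ (α : Multiset ℂ) (c : ℂ), c ≠ 0 ∧
        π.1.HasSatakeParamAt v α ∧ π'.1.HasSatakeParamAt v (α.map (c * ·))) →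
      IsSatakeSelfTwist π.1 → IsSatakeSelfTwist π'.1 →
      ∃ χ : HeckeCharacter F, IsSatakeTwistBy π.1 π'.1 χ) :
    Ramakrishnan2000_multiplicityOneSL2 :=
  Ramakrishnan2000_multiplicityOneSL2.of_boxTimes_cuspidal hB
    (fun F _ _ h2 _ π π' hLL hπ _ =>
      Ramakrishnan2000_lemma414_of_JS_of_sSup_irreducible hJ1 hJ2 hJ3 hGJ (hAss F h2) (hL2 F h2)
        (hss F h2) π π' hLL hπ)
    hdih

end Leaves

end Literature.NumberTheory.Automorphic

end
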